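import Mathlib
import Literature.Analysis.FluidPDE.ClassicalSolution
import Literature.Analysis.FluidPDE.VectorCalculus
import Literature.Analysis.FluidPDE.Vorticity
import Literature.Analysis.FluidPDE.NSVorticityProofs
import Summits.NavierStokesRegularity.NavierStokesRegularity.Theorems.SlicedKelvinDefs
import Summits.NavierStokesRegularity.NavierStokesRegularity.Theorems.SlicedKelvinPlanarFluxAPrioriFoldLawSpaceTime

/-!
# Crux `SlicedKelvin.PlanarFluxAPriori` (stmt-NavierStokesRegularity-15600), line `registered`
  (skeleton `Cruxes/PlanarFluxAPriori/Lines/birth.lean`, rev 2): STUB `stub_foldLawPackage`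

Lands `--supports stmt-NavierStokesRegularity-15600` the registered stub `stub_foldLawPackage`: the
ε-FOLD-LAW SUBSOLUTION PACKAGE `Theorems.SlicedKelvin.FoldLawSubsolution ν T u` of a classical
Navier–Stokes solution `u` on `[0, T)` from (i) the frame-covariant ε-fold law identity
`Theorems.SlicedKelvin.EpsFoldLawOn` for smooth divergence-free fields with cubic decay (hypothesis; the
neighbouring stub `stub_epsFoldLaw`) and (ii) cubic decay of `u, Du, D²u, D³u` uniformly on every `[0, t]`,
`t < T` (hypothesis; the neighbouring stub `stub_decayPersistence`).

For `t ∈ (0,T)`, `ε ∈ (0,1)` and a frame `R` (normal `n = R e₂`, planes `P_c : y ↦ R(y₀, y₁, c)`), with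
`f = ⟪curl u(τ), n⟫`, `F_ε(s) = √(s² + ε²)`, `w = νΔω − (u·∇)ω + (ω·∇)u`:
* `φ(τ,c) = ∫ (F_ε(f) − ε) ∘ P_c` (`= fluxProfile`), `S = foldSource` (definitional);
* `φₜ = ∫ F_ε'(f)⟪w, n⟫ ∘ P_c`, `φ₁ = ∫ D(F_ε∘f)[n] ∘ P_c`, `φ₂ = ∫ D(D(F_ε∘f)[n])[n] ∘ P_c`;
* joint continuity, `∂_τφ = φₜ`, `∂_cφ = φ₁`, `∂_cφ₁ = φ₂` and the uniform bounds are the dominated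
  convergence lemmas of `…PlaneCalculus` fed with the joint smoothness / vorticity equation of
  `…FoldLawSpaceTime` and the `(1 + ‖x‖)⁻³` bounds of `…FoldLawDecay`;
* THE INEQUALITY `φₜ − νφ₂ ≤ S`: by the ε-fold law at `v = u(τ)`,
  `φₜ − νφ₂ = −ν∫F_ε''|∇f|² − ∫(transport) − ε²∫(stretching) ≤ ∫ s_ε ∘ P_c ≤ ∫ (s_ε)⁺ ∘ P_c = S`.
-/

noncomputable section

-- Problem = summit for this single-conjunct summit: the duplicate namespace component is deliberate.
set_option linter.dupNamespace false

namespace Summit.NavierStokesRegularity.NavierStokesRegularity.Theorems.SlicedKelvinPlanarFluxAPriori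

open MeasureTheory Set Filter Topology
open scoped RealInnerProductSpace Laplacian ContDiff
open Literature.Analysis.FluidPDE
open Summit.NavierStokesRegularity.NavierStokesRegularity.Theorems.SlicedKelvin

/-- **STUB `stub_foldLawPackage`** of the birth skeleton of `SlicedKelvin.PlanarFluxAPriori`: the ε-fold
law identity (for smooth divergence-free fields with cubic decay) and cubic decay of the first three
derivatives of a classical Navier–Stokes solution on compact time slabs imply the ε-fold-law subsolution
package `FoldLawSubsolution ν T u` (see the module docstring for the witnesses). -/
theorem stub_foldLawPackage : (∀ (ν ε c : ℝ), 0 < ε → ∀ (R : EuclideanSpace ℝ (Fin 3) ≃ₗᵢ[ℝ] EuclideanSpace ℝ (Fin 3)) (v : EuclideanSpace ℝ (Fin 3) → EuclideanSpace ℝ (Fin 3)), ContDiff ℝ (⊤ : ℕ∞) v → (∃ C : ℝ, ∀ (x : EuclideanSpace ℝ (Fin 3)) (k : ℕ), k ≤ 3 → (1 + ‖x‖) ^ 3 * ‖iteratedFDeriv ℝ k v x‖ ≤ C) → Literature.Analysis.FluidPDE.VectorCalculus.IsDivFree v → Summit.NavierStokesRegularity.NavierStokesRegularity.Theorems.SlicedKelvin.EpsFoldLawOn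 ν ε c R v) → ∀ (ν T : ℝ), 0 < ν → 0 < T → ∀ (u : ℝ → EuclideanSpace ℝ (Fin 3) → EuclideanSpace ℝ (Fin 3)) (p : ℝ → EuclideanSpace ℝ (Fin 3) → ℝ), Literature.Analysis.FluidPDE.IsClassicalNSSolutionOn (Set.Ico 0 T) ν 0 u p → (∀ t ∈ Set.Ico 0 T, ∃ C₀ : ℝ, ∀ s ∈ Set.Icc 0 t, ∀ (x : EuclideanSpace ℝ (Fin 3)) (k : ℕ), k ≤ 3 → (1 + ‖x‖) ^ 3 * ‖iteratedFDeriv ℝ k (u s) x‖ ≤ C₀) → Summit.NavierStokesRegularity.NavierStokesRegularity.Theorems.SlicedKelvin.FoldLawSubsolution ν T u := by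
  intro hId ν T hν hT u p hcl hdec t ht ε hε R
  -- the time slab and the decay constant
  have hU : UniqueDiffOn ℝ (Ico 0 T) := uniqueDiffOn_Ico 0 T
  have htS : t ∈ Ico 0 T := ⟨ht.1.le, ht.2⟩
  obtain ⟨C, hC⟩ := hdec t htS
  have hC0 : 0 ≤ C := decay_const_nonneg (hC t ⟨ht.1.le, le_rfl⟩)
  have hIcc : ∀ s ∈ Icc 0 t, s ∈ Ico 0 T := fun s hs => ⟨hs.1, hs.2.trans_lt ht.2⟩
  have hIooT : ∀ s ∈ Ioo 0 t, s ∈ Ioo 0 T := fun s hs => ⟨hs.1, hs.2.trans ht.2⟩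
  have hsm : IsSmoothSpaceTimeOn (Ico 0 T) u := hcl.smooth_velocity
  have hv : ∀ s ∈ Ico 0 T, ContDiff ℝ ∞ (u s) := fun s hs => hcl.contDiff_velocity hs
  have hε0 : 0 < ε := hε.1
  have hn : ‖R (EuclideanSpace.single 2 (1 : ℝ))‖ = 1 := norm_frame R 2
  -- the constants
  have hκ : 0 ≤ ‖curlCLM‖ := norm_nonneg curlCLM
  have hK₀ : 0 ≤ ‖curlCLM‖ * C := mul_nonneg hκ hC0
  have hKₜ : 0 ≤ 3 * |ν| * (‖curlCLM‖ * C) + 2 * ‖curlCLM‖ * C ^ 2 :=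
    add_nonneg (mul_nonneg (mul_nonneg (by norm_num) (abs_nonneg ν)) hK₀)
      (mul_nonneg (mul_nonneg zero_le_two hκ) (sq_nonneg C))
  have hK₂ : 0 ≤ ‖curlCLM‖ * C + ε⁻¹ * (‖curlCLM‖ * C) ^ 2 :=
    add_nonneg hK₀ (mul_nonneg (inv_nonneg.2 hε0.le) (sq_nonneg _))
  have hI := integral_rpow_neg_three_nonneg
  -- joint continuity of the integrand fields on `[0,T) × ℝ³`
  have J₀ := (isSmoothSpaceTimeOn_sqrtReg_sub hsm hU hε0 (R (EuclideanSpace.single 2 1))).continuousOn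
  have Jₜ := (isSmoothSpaceTimeOn_timeDensity hsm hU hε0 (R (EuclideanSpace.single 2 1)) ν).continuousOn
  have J₂ := (isSmoothSpaceTimeOn_fderiv_fderiv_sqrtReg_apply hsm hU hε0
    (R (EuclideanSpace.single 2 1))).continuousOn
  have hsub₁ : Icc 0 t ×ˢ (univ : Set (EuclideanSpace ℝ (Fin 3))) ⊆ Ico 0 T ×ˢ univ :=
    prod_mono (fun s hs => hIcc s hs) Subset.rfl
  have hsub₂ : Ioo 0 t ×ˢ (univ : Set (EuclideanSpace ℝ (Fin 3))) ⊆ Ico 0 T ×ˢ univ :=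
    prod_mono (fun s hs => hIcc s (Ioo_subset_Icc_self hs)) Subset.rfl
  refine ⟨fun τ c => ∫ y : EuclideanSpace ℝ (Fin 2), (Real.sqrt (inner ℝ (Literature.Analysis.FluidPDE.curl (u τ) (R (WithLp.toLp 2 ![y 0, y 1, c]))) (R (EuclideanSpace.single 2 1)) ^ 2 + ε ^ 2) - ε), fun τ c => foldSource u R ε τ c, fun τ c => ∫ y : EuclideanSpace ℝ (Fin 2), inner ℝ (Literature.Analysis.FluidPDE.curl (u τ) (R (WithLp.toLp 2 ![y 0, y 1, c]))) (R (EuclideanSpace.single 2 1)) / Real.sqrt (inner ℝ (Literature.Analysis.FluidPDE.curl (u τ) (R (WithLp.toLp 2 ![y 0, y 1, c]))) (R (EuclideanSpace.single 2 1)) ^ 2 + ε ^ 2) * inner ℝ (ν • Laplacian.laplacian (Literature.Analysis.FluidPDE.curl (u τ)) (R (WithLp.toLp 2 ![y 0, y 1, c])) - Literature.Analysis.FluidPDE.convect (u τ) (Literature.Analysis.FluidPDE.curl (u τ)) (R (WithLp.toLp 2 ![y 0, y 1, c])) + Literature.Analysis.FluidPDE.convect (Literature.Analysis.FluidPDE.curl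 (u τ)) (u τ) (R (WithLp.toLp 2 ![y 0, y 1, c]))) (R (EuclideanSpace.single 2 1)), fun τ c => ∫ y : EuclideanSpace ℝ (Fin 2), fderiv ℝ (fun x => Real.sqrt (inner ℝ (Literature.Analysis.FluidPDE.curl (u τ) x) (R (EuclideanSpace.single 2 1)) ^ 2 + ε ^ 2)) (R (WithLp.toLp 2 ![y 0, y 1, c])) (R (EuclideanSpace.single 2 1)), fun τ c => ∫ y : EuclideanSpace ℝ (Fin 2), fderiv ℝ (fun x => fderiv ℝ (fun x => Real.sqrt (inner ℝ (Literature.Analysis.FluidPDE.curl (u τ) x) (R (EuclideanSpace.single 2 1)) ^ 2 + ε ^ 2)) x (R (EuclideanSpace.single 2 1))) (R (WithLp.toLp 2 ![y 0, y 1, c])) (R (EuclideanSpace.single 2 1)),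
    (‖curlCLM‖ * C + (3 * |ν| * (‖curlCLM‖ * C) + 2 * ‖curlCLM‖ * C ^ 2) + ‖curlCLM‖ * C +
      (‖curlCLM‖ * C + ε⁻¹ * (‖curlCLM‖ * C) ^ 2)) *
      ∫ y : EuclideanSpace ℝ (Fin 2), (1 + ‖y‖) ^ (-(3 : ℝ)),
    fun τ c => rfl, fun τ c => rfl, ?_, ?_, ?_, ?_, ?_, ?_, ?_, ?_, ?_, ?_, ?_, ?_⟩
  · -- (3) `φ` is jointly continuous on `[0,t] × ℝ`
    exact continuousOn_planeIntegral R (J₀.mono hsub₁)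
      fun τ hτ x => abs_sqrtReg_sub_le_decay (hC τ hτ) hn hε0.le x
  · -- (4) `φₜ` is jointly continuous on `(0,t) × ℝ`
    exact continuousOn_planeIntegral R (Jₜ.mono hsub₂) fun τ hτ x =>
      abs_timeDensity_le_decay (hv τ (hIcc τ (Ioo_subset_Icc_self hτ))) (hC τ (Ioo_subset_Icc_self hτ))
        hn ν ε x
  · -- (5) `φ₂` is jointly continuous on `(0,t) × ℝ`
    exact continuousOn_planeIntegral R (J₂.mono hsub₂) fun τ hτ x =>
      abs_fderiv_fderiv_sqrtReg_apply_apply_le_decay (hv τ (hIcc τ (Ioo_subset_Icc_self hτ)))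
        (hC τ (Ioo_subset_Icc_self hτ)) hn hε0 x
  · -- (6) `∂_τ φ = φₜ` on `(0,t)` (vorticity equation under the plane integral)
    intro τ hτ c
    have hτI : τ ∈ Icc 0 t := Ioo_subset_Icc_self hτ
    exact hasDerivAt_planeIntegral_time R (Ioo_mem_nhds hτ.1 hτ.2)
      (fun σ hσ => continuous_sqrtReg_sub (hv σ (hIcc σ (Ioo_subset_Icc_self hσ))) _ ε)
      (continuous_slice_of_continuousOn Jₜ (hIcc τ hτI))
      (fun x => abs_sqrtReg_sub_le_decay (hC τ hτI) hn hε0.le x)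
      (fun σ hσ x => abs_timeDensity_le_decay (hv σ (hIcc σ (Ioo_subset_Icc_self hσ)))
        (hC σ (Ioo_subset_Icc_self hσ)) hn ν ε x)
      (fun σ hσ x => hasDerivAt_sqrtReg_sub_time ν T ε u p hcl hε0 _ σ (hIooT σ hσ) x) c
  · -- (7) `∂_c φ = φ₁` (differentiation under the plane integral along the normal)
    intro τ hτ c
    have hτI : τ ∈ Icc 0 t := Ioo_subset_Icc_self hτ
    have hvτ := hv τ (hIcc τ hτI)
    have hG : ContDiff ℝ 1 (fun x => Real.sqrt (⟪curl (u τ) x, R (EuclideanSpace.single 2 1)⟫ ^ 2 + ε ^ 2) - ε) :=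
      ((contDiff_sqrtReg_inner_curl hvτ hε0 _).sub contDiff_const).of_le (by norm_cast)
    refine (hasDerivAt_planeIntegral_height R _ _ _ hG
      (fun x => abs_sqrtReg_sub_le_decay (hC τ hτI) hn hε0.le x)
      (fun x => norm_fderiv_sqrtReg_sub_le_decay hvτ (hC τ hτI) hn hε0 x) c).congr_deriv ?_
    simp_rw [fderiv_sub_const]
  · -- (8) `∂_c φ₁ = φ₂`
    intro τ hτ c
    have hτI : τ ∈ Icc 0 t := Ioo_subset_Icc_self hτ
    have hvτ := hv τ (hIcc τ hτI)
    have hG : ContDiff ℝ 1 (fun x => fderiv ℝ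
        (fun x => Real.sqrt (⟪curl (u τ) x, R (EuclideanSpace.single 2 1)⟫ ^ 2 + ε ^ 2)) x
        (R (EuclideanSpace.single 2 1))) :=
      (((contDiff_sqrtReg_inner_curl hvτ hε0 _).fderiv_right (m := ∞) (by simp)).clm_apply
        contDiff_const).of_le (by norm_cast)
    exact hasDerivAt_planeIntegral_height R _ _ _ hG
      (fun x => abs_fderiv_sqrtReg_apply_le_decay hvτ (hC τ hτI) hn hε0 x)
      (fun x => norm_fderiv_fderiv_sqrtReg_apply_le_decay hvτ (hC τ hτI) hn hε0 x) c
  · -- (9) `|φ| ≤ B` on `[0,t] × ℝ`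
    intro τ hτ c
    exact (abs_planeIntegral_le R hK₀ (fun x => abs_sqrtReg_sub_le_decay (hC τ hτ) hn hε0.le x) c).trans
      (mul_le_mul_of_nonneg_right (by linarith) hI)
  · -- (10) `|φₜ| ≤ B` on `(0,t) × ℝ`
    intro τ hτ c
    have hτI : τ ∈ Icc 0 t := Ioo_subset_Icc_self hτ
    exact (abs_planeIntegral_le R hKₜ (fun x => abs_timeDensity_le_decay (hv τ (hIcc τ hτI)) (hC τ hτI)
      hn ν ε x) c).trans (mul_le_mul_of_nonneg_right (by linarith) hI)
  · -- (11) `|φ₁| ≤ B`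
    intro τ hτ c
    have hτI : τ ∈ Icc 0 t := Ioo_subset_Icc_self hτ
    exact (abs_planeIntegral_le R hK₀ (fun x => abs_fderiv_sqrtReg_apply_le_decay (hv τ (hIcc τ hτI))
      (hC τ hτI) hn hε0 x) c).trans (mul_le_mul_of_nonneg_right (by linarith) hI)
  · -- (12) `|φ₂| ≤ B`
    intro τ hτ c
    have hτI : τ ∈ Icc 0 t := Ioo_subset_Icc_self hτ
    exact (abs_planeIntegral_le R hK₂ (fun x => abs_fderiv_fderiv_sqrtReg_apply_apply_le_decay
      (hv τ (hIcc τ hτI)) (hC τ hτI) hn hε0 x) c).trans (mul_le_mul_of_nonneg_right (by linarith) hI)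
  · -- (13) THE SUBSOLUTION INEQUALITY `φₜ − ν φ₂ ≤ S`
    intro τ hτ c
    have hτI : τ ∈ Icc 0 t := Ioo_subset_Icc_self hτ
    have hτS : τ ∈ Ico 0 T := hIcc τ hτI
    have hvτ := hv τ hτS
    have hCτ := hC τ hτI
    -- the ε-fold law at `v = u(τ)`
    have hid := epsFoldLawOn_explicit (hId ν ε c hε0 R (u τ) hvτ ⟨C, hCτ⟩ (hcl.divFree τ hτS))
    -- `∫ s_ε ≤ ∫ (s_ε)⁺ = S`
    have hint : Integrable (fun y : EuclideanSpace ℝ (Fin 2) =>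
        foldDensity (u τ) R ε (R (WithLp.toLp 2 ![y 0, y 1, c]))) :=
      integrable_plane_of_norm_le R (continuous_foldDensity hvτ hε0 R)
        (fun x => by
          rw [Real.norm_eq_abs]
          exact abs_foldDensity_le_decay (u τ) C ε R hvτ hCτ hε0 x) c
    have hmono : (∫ y : EuclideanSpace ℝ (Fin 2), foldDensity (u τ) R ε (R (WithLp.toLp 2 ![y 0, y 1, c]))) ≤
        foldSource u R ε τ c :=
      integral_mono hint hint.pos_part fun y => le_max_left _ _
    exact foldLaw_ineq hid hν.le (integral_annihilation_nonneg R c) hmono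
      (integral_foldDensity_plane hvτ hCτ hε0 R c)
  · -- (14) the regularised density is integrable on every plane at time `t`
    intro c
    exact integrable_plane_of_norm_le R (continuous_sqrtReg_sub (hv t htS) _ ε)
      (fun x => by
        rw [Real.norm_eq_abs]
        exact abs_sqrtReg_sub_le_decay (hC t ⟨ht.1.le, le_rfl⟩) hn hε0.le x) c

end Summit.NavierStokesRegularity.NavierStokesRegularity.Theorems.SlicedKelvinPlanarFluxAPriori

end
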